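import Literature.Analysis.FluidPDE.TaoAveragedSlotFourier
import Literature.Analysis.FluidPDE.TaoAveragedConjugation
import Literature.Analysis.FluidPDE.TaoAveragedComplexAverage
import HarnessLib

/-!
# Tao's averaged Navier–Stokes setting: `H^s` bounds for the slot operators `m(D) Rot_R Dil_λ`

T. Tao, *Finite time blowup for an averaged three-dimensional Navier–Stokes equation*,
J. Amer. Math. Soc. **29** (2016), 601–674 = arXiv:1402.0290v3 (held as `paper:arxiv-1402.0290`),
§1.1, p. 6: the rotation operators "are uniformly bounded on `H¹⁰_df(ℝ³)`", the dilation
operators (1.11) "do not quite preserve the `H¹⁰_df(ℝ³)` norm, but if `λ` is restricted to a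
compact subset of `(0,+∞)` then these operators (and their inverses) will be uniformly bounded on
`H¹⁰_df(ℝ³)`", and the Fourier multipliers of order `0` are bounded (on `L²`-Sobolev spaces by
Plancherel, with norm `≤ ‖m‖₀ = sup |m|`).

Third support file of the discharge of the named fact
`Literature.Analysis.FluidPDE.Tao2016.complexAverage_linear_right`
(`TaoAveragedComplexAverage.lean`). With the weighted integral
`sobolevWeightIntegral s ĝ = ∫ (1+|ξ|²)^s ‖ĝ(ξ)‖² dξ` of the accepted `TaoAveragedConjugation.lean`
(`‖u‖_{H^s} = sobolevWeightIntegral s û ^ (1/2)`, `eFourierSobolevNorm_eq`) and the Fourier-side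
formulas of the accepted `TaoAveragedSlotFourier.lean`:

* `enorm_le_symbolSeminorm_zero` — `|m(ξ)| ≤ ‖m‖₀` for `ξ ≠ 0`;
* `sobolevWeightIntegral_fourierMultiplier_le` — `‖m(D)u‖²_{H^s} ≤ M² ‖u‖²_{H^s}` if `|m| ≤ M` a.e.;
* `sobolevWeightIntegral_fourierFn_rot` — `‖Rot_R u‖_{H^s} = ‖u‖_{H^s}`;
* `sobolevWeightIntegral_dilate`, `sobolevWeightIntegral_fourierFn_dil_le` —
  `‖Dil_λ u‖²_{H^s} = ∫ (1+λ²|η|²)^s |û(η)|² dη ≤ max(1,λ)^{2s} ‖u‖²_{H^s}` (`s ≥ 0`);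
* `ComplexAveragingDatum.sobolevWeightIntegral_slot_le`, `….eFourierSobolevNorm_slot_le`,
  `….enorm_slot_le` — for a slot `A = m_{i,ω}(D) Rot_{R_{i,ω}} Dil_{λ_{i,ω}}` of a complex average
  (Def. 3.4): `‖A u‖_{H^s} ≤ ‖m_{i,ω}‖₀ max(1,λ_{i,ω})^s ‖u‖_{H^s}` and `‖A u‖_{L²} ≤ ‖m_{i,ω}‖₀ ‖u‖_{L²}`.

## References

* T. Tao, J. Amer. Math. Soc. 29 (2016), 601–674, arXiv:1402.0290v3, §1.1 p. 6 ((1.10)–(1.12)),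
  §3.1 Def. 3.4 p. 15. Key `Tao2016AveragedNS`.
-/

noncomputable section

open MeasureTheory Set Filter Topology FourierTransform Complex
open scoped ENNReal NNReal

namespace Literature.Analysis.FluidPDE.Tao2016

section Operators

variable (s : ℝ) (R : EuclideanSpace ℝ (Fin 3) ≃ₗᵢ[ℝ] EuclideanSpace ℝ (Fin 3)) (u : L2C)

/-! ### The multiplier -/

/-- `|m(ξ)| ≤ ‖m‖₀` for every `ξ ≠ 0` (the `k = 0` seminorm (1.10) is `sup_{ξ ≠ 0} |m(ξ)|`). [cite: Tao2016AveragedNS, (1.10)] -/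
theorem enorm_le_symbolSeminorm_zero (m : EuclideanSpace ℝ (Fin 3) → ℂ) {ξ : EuclideanSpace ℝ (Fin 3)}
    (hξ : ξ ≠ 0) : ‖m ξ‖ₑ ≤ symbolSeminorm 0 m := by
  have h : ‖m ξ‖ₑ = (‖ξ‖₊ : ℝ≥0∞) ^ 0 * ‖iteratedFDeriv ℝ 0 m ξ‖₊ := by
    rw [pow_zero, one_mul, enorm_eq_nnnorm, ENNReal.coe_inj, ← NNReal.coe_inj, coe_nnnorm,
      coe_nnnorm, norm_iteratedFDeriv_zero]
  rw [h]
  exact le_iSup₂ (f := fun (ξ : EuclideanSpace ℝ (Fin 3)) (_ : ξ ∈ ({0}ᶜ : Set _)) =>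
    (‖ξ‖₊ : ℝ≥0∞) ^ 0 * (‖iteratedFDeriv ℝ 0 m ξ‖₊ : ℝ≥0∞)) ξ hξ

/-- `|m(ξ)| ≤ ‖m‖₀` for a.e. `ξ`. [cite: Tao2016AveragedNS, (1.10)] -/
theorem ae_enorm_le_symbolSeminorm_zero (m : EuclideanSpace ℝ (Fin 3) → ℂ) :
    ∀ᵐ ξ ∂(volume : Measure (EuclideanSpace ℝ (Fin 3))), ‖m ξ‖ₑ ≤ symbolSeminorm 0 m := by
  have h0 : ({0}ᶜ : Set (EuclideanSpace ℝ (Fin 3))) ∈ ae (volume : Measure _) :=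
    compl_mem_ae_iff.mpr (measure_singleton _)
  filter_upwards [h0] with ξ hξ
  exact enorm_le_symbolSeminorm_zero m hξ

/-- **`m(D)` is bounded on `H^s` by `sup |m|`**: if `|m| ≤ M` a.e. then
`∫ (1+|ξ|²)^s |m(ξ) û(ξ)|² ≤ M² ∫ (1+|ξ|²)^s |û(ξ)|²` (Plancherel-side boundedness of order-`0`
multipliers on `L²`-Sobolev spaces, Tao p. 6). [cite: Tao2016AveragedNS, §1.1 p. 6] -/
theorem sobolevWeightIntegral_fourierMultiplier_le
    {m : Lp ℂ ∞ (volume : Measure (EuclideanSpace ℝ (Fin 3)))} {M : ℝ≥0∞}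
    (hM : ∀ᵐ ξ ∂(volume : Measure (EuclideanSpace ℝ (Fin 3))), ‖(m : EuclideanSpace ℝ (Fin 3) → ℂ) ξ‖ₑ ≤ M) :
    sobolevWeightIntegral s (fourierFn (fourierMultiplier m u)) ≤
      M ^ 2 * sobolevWeightIntegral s (fourierFn u) := by
  unfold sobolevWeightIntegral
  have hmeas : AEMeasurable (fun ξ : EuclideanSpace ℝ (Fin 3) =>
      ENNReal.ofReal ((1 + ‖ξ‖ ^ 2) ^ s) * ‖fourierFn u ξ‖ₑ ^ 2) volume :=
    (measurable_sobolevWeight s).aemeasurable.mul ((aestronglyMeasurable_fourierFn u).enorm.pow_const 2)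
  calc ∫⁻ ξ, ENNReal.ofReal ((1 + ‖ξ‖ ^ 2) ^ s) * ‖fourierFn (fourierMultiplier m u) ξ‖ₑ ^ 2
      ≤ ∫⁻ ξ, M ^ 2 * (ENNReal.ofReal ((1 + ‖ξ‖ ^ 2) ^ s) * ‖fourierFn u ξ‖ₑ ^ 2) := by
        refine lintegral_mono_ae ?_
        filter_upwards [fourierFn_fourierMultiplier m u, hM] with ξ h1 h2
        rw [h1, enorm_smul, mul_pow]
        calc ENNReal.ofReal ((1 + ‖ξ‖ ^ 2) ^ s) * (‖(m : EuclideanSpace ℝ (Fin 3) → ℂ) ξ‖ₑ ^ 2 *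
              ‖fourierFn u ξ‖ₑ ^ 2)
            ≤ ENNReal.ofReal ((1 + ‖ξ‖ ^ 2) ^ s) * (M ^ 2 * ‖fourierFn u ξ‖ₑ ^ 2) := by gcongr
          _ = _ := by ring
    _ = M ^ 2 * ∫⁻ ξ, ENNReal.ofReal ((1 + ‖ξ‖ ^ 2) ^ s) * ‖fourierFn u ξ‖ₑ ^ 2 :=
        lintegral_const_mul'' _ hmeas

/-! ### The rotation -/

/-- The Sobolev weighted integral is invariant under `ĝ ↦ R_ℂ ĝ(R⁻¹ ·)` (the weight is radial,
`R_ℂ` is an isometry, Lebesgue measure is rotation invariant). [folklore] -/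
theorem sobolevWeightIntegral_comp_rot (g : EuclideanSpace ℝ (Fin 3) → EuclideanSpace ℂ (Fin 3)) :
    sobolevWeightIntegral s
        (fun ξ => complexifyCLM R.toLinearIsometry.toContinuousLinearMap (g (R.symm ξ))) =
      sobolevWeightIntegral s g := by
  unfold sobolevWeightIntegral
  calc ∫⁻ ξ, ENNReal.ofReal ((1 + ‖ξ‖ ^ 2) ^ s) *
        ‖complexifyCLM R.toLinearIsometry.toContinuousLinearMap (g (R.symm ξ))‖ₑ ^ 2
      = ∫⁻ ξ, (fun η => ENNReal.ofReal ((1 + ‖η‖ ^ 2) ^ s) * ‖g η‖ₑ ^ 2) (R.symm ξ) := by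
        refine lintegral_congr fun ξ => ?_
        simp only []
        rw [← ofReal_norm (complexifyCLM _ _), norm_complexifyCLM, ofReal_norm,
          LinearIsometryEquiv.norm_map]
    _ = ∫⁻ η, ENNReal.ofReal ((1 + ‖η‖ ^ 2) ^ s) * ‖g η‖ₑ ^ 2 :=
        R.symm.measurePreserving.lintegral_comp_emb R.symm.toHomeomorph.measurableEmbedding
          (fun η => ENNReal.ofReal ((1 + ‖η‖ ^ 2) ^ s) * ‖g η‖ₑ ^ 2)

/-- **`Rot_R` preserves every `H^s` norm**: `‖Rot_R u‖_{H^s} = ‖u‖_{H^s}` (Tao p. 6: "these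
rotation operators are uniformly bounded on `H¹⁰_df`"). [cite: Tao2016AveragedNS, §1.1 p. 6] -/
theorem sobolevWeightIntegral_fourierFn_rot :
    sobolevWeightIntegral s (fourierFn (rot R u)) = sobolevWeightIntegral s (fourierFn u) := by
  rw [sobolevWeightIntegral_congr_ae (fourierFn_rot R u)]
  exact sobolevWeightIntegral_comp_rot s R (fourierFn u)

/-! ### The dilation -/

/-- `(a^{3/2})² = a³` in `ℝ≥0∞`, for the unitary normalisation of `Dil_a`. [folklore] -/
theorem enorm_rpow_three_halves_sq {a : ℝ} (ha : 0 < a) :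
    ‖(((a ^ (3 / 2 : ℝ) : ℝ)) : ℂ)‖ₑ ^ 2 = ENNReal.ofReal (a ^ 3) := by
  rw [← ofReal_norm, Complex.norm_real, Real.norm_of_nonneg (Real.rpow_nonneg ha.le _),
    ← ENNReal.ofReal_pow (Real.rpow_nonneg ha.le _), ← Real.rpow_natCast,
    ← Real.rpow_mul ha.le, show (3 / 2 : ℝ) * ((2 : ℕ) : ℝ) = ((3 : ℕ) : ℝ) by norm_num,
    Real.rpow_natCast]

/-- **Change of variables for a dilated field**:
`∫ (1+|ξ|²)^s |a^{3/2} ĝ(aξ)|² dξ = ∫ (1+|η/a|²)^s |ĝ(η)|² dη` (`a > 0`). [folklore] -/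
theorem sobolevWeightIntegral_dilate {a : ℝ} (ha : 0 < a)
    (g : EuclideanSpace ℝ (Fin 3) → EuclideanSpace ℂ (Fin 3)) :
    sobolevWeightIntegral s (fun ξ => (((a ^ (3 / 2 : ℝ) : ℝ)) : ℂ) • g (a • ξ)) =
      ∫⁻ η, ENNReal.ofReal ((1 + ‖a⁻¹ • η‖ ^ 2) ^ s) * ‖g η‖ₑ ^ 2 := by
  unfold sobolevWeightIntegral
  have hemb : MeasurableEmbedding (fun ξ : EuclideanSpace ℝ (Fin 3) => a • ξ) :=
    (Homeomorph.smulOfNeZero a ha.ne').measurableEmbedding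
  have hF : (fun ξ : EuclideanSpace ℝ (Fin 3) => ENNReal.ofReal ((1 + ‖ξ‖ ^ 2) ^ s) *
      ‖(((a ^ (3 / 2 : ℝ) : ℝ)) : ℂ) • g (a • ξ)‖ₑ ^ 2) =
      fun ξ => (fun η => ENNReal.ofReal (a ^ 3) *
        (ENNReal.ofReal ((1 + ‖a⁻¹ • η‖ ^ 2) ^ s) * ‖g η‖ₑ ^ 2)) (a • ξ) := by
    funext ξ
    simp only [inv_smul_smul₀ ha.ne']
    rw [enorm_smul, mul_pow, enorm_rpow_three_halves_sq ha]
    ring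
  rw [hF, ← hemb.lintegral_map (fun η => ENNReal.ofReal (a ^ 3) *
      (ENNReal.ofReal ((1 + ‖a⁻¹ • η‖ ^ 2) ^ s) * ‖g η‖ₑ ^ 2)),
    Measure.map_addHaar_smul volume ha.ne', lintegral_smul_measure,
    lintegral_const_mul' _ _ ENNReal.ofReal_ne_top, smul_eq_mul, ← mul_assoc, finrank_euclideanSpace,
    Fintype.card_fin, ← ENNReal.ofReal_mul (abs_nonneg _), abs_of_pos (inv_pos.2 (pow_pos ha 3)),
    inv_mul_cancel₀ (pow_pos ha 3).ne', ENNReal.ofReal_one, one_mul]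

/-- The elementary weight comparison `(1 + |η/a|²)^s ≤ max(1, a⁻¹)^{2s} (1 + |η|²)^s`
(`s ≥ 0`). [folklore] -/
theorem sobolevWeight_dilate_le {s : ℝ} (hs : 0 ≤ s) {a : ℝ} (ha : 0 < a) (η : EuclideanSpace ℝ (Fin 3)) :
    (1 + ‖a⁻¹ • η‖ ^ 2) ^ s ≤ (max 1 a⁻¹ ^ 2) ^ s * (1 + ‖η‖ ^ 2) ^ s := by
  rw [← Real.mul_rpow (by positivity) (by positivity)]
  refine Real.rpow_le_rpow (by positivity) ?_ hs
  rw [norm_smul, mul_pow, Real.norm_of_nonneg (inv_pos.2 ha).le]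
  have h1 : (1 : ℝ) ≤ max 1 a⁻¹ ^ 2 := one_le_pow₀ (le_max_left _ _)
  have h2 : a⁻¹ ^ 2 ≤ max 1 a⁻¹ ^ 2 := pow_le_pow_left₀ (inv_pos.2 ha).le (le_max_right _ _) 2
  nlinarith [sq_nonneg ‖η‖, h1, h2, mul_le_mul_of_nonneg_right h2 (sq_nonneg ‖η‖)]

/-- `∫ (1+|ξ|²)^s |a^{3/2} ĝ(aξ)|² dξ ≤ max(1, a⁻¹)^{2s} ∫ (1+|η|²)^s |ĝ(η)|² dη` (`a > 0`,
`s ≥ 0`). [folklore] -/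
theorem sobolevWeightIntegral_dilate_le {s : ℝ} (hs : 0 ≤ s) {a : ℝ} (ha : 0 < a)
    (g : EuclideanSpace ℝ (Fin 3) → EuclideanSpace ℂ (Fin 3)) :
    sobolevWeightIntegral s (fun ξ => (((a ^ (3 / 2 : ℝ) : ℝ)) : ℂ) • g (a • ξ)) ≤
      ENNReal.ofReal ((max 1 a⁻¹ ^ 2) ^ s) * sobolevWeightIntegral s g := by
  rw [sobolevWeightIntegral_dilate s ha g, sobolevWeightIntegral,
    ← lintegral_const_mul' _ _ ENNReal.ofReal_ne_top]
  refine lintegral_mono fun η => ?_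
  rw [← mul_assoc, ← ENNReal.ofReal_mul (by positivity)]
  gcongr
  exact sobolevWeight_dilate_le hs ha η

/-- **`Dil_λ` is bounded on `H^s` for `λ` in a compact subset of `(0,∞)`**:
`‖Dil_λ u‖²_{H^s} ≤ max(1,λ)^{2s} ‖u‖²_{H^s}` (`λ > 0`, `s ≥ 0`; Tao p. 6). [cite: Tao2016AveragedNS, §1.1 p. 6] -/
theorem sobolevWeightIntegral_fourierFn_dil_le {s : ℝ} (hs : 0 ≤ s) {c : ℝ} (hc : 0 < c) :
    sobolevWeightIntegral s (fourierFn (dil c u)) ≤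
      ENNReal.ofReal ((max 1 c ^ 2) ^ s) * sobolevWeightIntegral s (fourierFn u) := by
  rw [sobolevWeightIntegral_congr_ae (fourierFn_dil u hc)]
  have h := sobolevWeightIntegral_dilate_le hs (inv_pos.2 hc) (fourierFn u)
  rwa [inv_inv] at h

end Operators

/-! ### The slots of a complex average (Def. 3.4) -/

namespace ComplexAveragingDatum

variable (𝒟 : ComplexAveragingDatum) (i : Fin 3) (θ : 𝒟.Ω)

/-- The symbol of a slot is a.e. bounded by its `k = 0` seminorm. [cite: Tao2016AveragedNS, (1.10)] -/
theorem ae_enorm_symbolLp_le :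
    ∀ᵐ ξ ∂(volume : Measure (EuclideanSpace ℝ (Fin 3))),
      ‖(𝒟.symbolLp i θ : EuclideanSpace ℝ (Fin 3) → ℂ) ξ‖ₑ ≤ symbolSeminorm 0 (𝒟.m i θ) := by
  unfold symbolLp
  filter_upwards [MemLp.coeFn_toLp ((𝒟.isComplexSymbol i θ).memLp_top),
    ae_enorm_le_symbolSeminorm_zero (𝒟.m i θ)] with ξ h1 h2
  rw [h1]
  exact h2

/-- **Slots are bounded on `H^s`**: for `A = m_{i,ω}(D) Rot_{R_{i,ω}} Dil_{λ_{i,ω}}` (a slot of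
(3.4)) and `s ≥ 0`,
`‖A u‖²_{H^s} ≤ ‖m_{i,ω}‖₀² max(1,λ_{i,ω})^{2s} ‖u‖²_{H^s}` (Tao p. 6: multipliers, rotations and
dilations with `λ ∈ [C₀⁻¹, C₀]` are uniformly bounded on `H¹⁰_df`). [cite: Tao2016AveragedNS, §1.1 p. 6 and Def. 3.4] -/
theorem sobolevWeightIntegral_slot_le {s : ℝ} (hs : 0 ≤ s) (u : L2C) :
    sobolevWeightIntegral s (fourierFn (𝒟.slot i θ u)) ≤
      symbolSeminorm 0 (𝒟.m i θ) ^ 2 * ENNReal.ofReal ((max 1 (𝒟.lam i θ) ^ 2) ^ s) *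
        sobolevWeightIntegral s (fourierFn u) := by
  unfold slot
  calc sobolevWeightIntegral s (fourierFn (fourierMultiplier (𝒟.symbolLp i θ)
        (rot (𝒟.R i θ) (dil (𝒟.lam i θ) u))))
      ≤ symbolSeminorm 0 (𝒟.m i θ) ^ 2 *
          sobolevWeightIntegral s (fourierFn (rot (𝒟.R i θ) (dil (𝒟.lam i θ) u))) :=
        sobolevWeightIntegral_fourierMultiplier_le s _ (𝒟.ae_enorm_symbolLp_le i θ)
    _ = symbolSeminorm 0 (𝒟.m i θ) ^ 2 * sobolevWeightIntegral s (fourierFn (dil (𝒟.lam i θ) u)) := by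
        rw [sobolevWeightIntegral_fourierFn_rot]
    _ ≤ symbolSeminorm 0 (𝒟.m i θ) ^ 2 * (ENNReal.ofReal ((max 1 (𝒟.lam i θ) ^ 2) ^ s) *
          sobolevWeightIntegral s (fourierFn u)) :=
        mul_le_mul' le_rfl (sobolevWeightIntegral_fourierFn_dil_le u hs (𝒟.lam_pos i θ))
    _ = _ := by ring

/-- The same bound for the norms: `‖A u‖_{H^s} ≤ ‖m_{i,ω}‖₀ max(1,λ_{i,ω})^s ‖u‖_{H^s}`. [cite: Tao2016AveragedNS, §1.1 p. 6 and Def. 3.4] -/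
theorem eFourierSobolevNorm_slot_le {s : ℝ} (hs : 0 ≤ s) (u : L2C) :
    FunctionSpaces.eFourierSobolevNorm s (𝒟.slot i θ u) ≤
      symbolSeminorm 0 (𝒟.m i θ) * ENNReal.ofReal (max 1 (𝒟.lam i θ) ^ s) *
        FunctionSpaces.eFourierSobolevNorm s u := by
  rw [eFourierSobolevNorm_eq, eFourierSobolevNorm_eq]
  calc sobolevWeightIntegral s (fourierFn (𝒟.slot i θ u)) ^ (1 / 2 : ℝ)
      ≤ (symbolSeminorm 0 (𝒟.m i θ) ^ 2 * ENNReal.ofReal ((max 1 (𝒟.lam i θ) ^ 2) ^ s) *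
          sobolevWeightIntegral s (fourierFn u)) ^ (1 / 2 : ℝ) :=
        ENNReal.rpow_le_rpow (𝒟.sobolevWeightIntegral_slot_le i θ hs u) (by norm_num)
    _ = _ := by
        rw [ENNReal.mul_rpow_of_nonneg _ _ (by norm_num), ENNReal.mul_rpow_of_nonneg _ _ (by norm_num)]
        congr 2
        · rw [← ENNReal.rpow_natCast, ← ENNReal.rpow_mul]
          norm_num
        · rw [ENNReal.ofReal_rpow_of_nonneg (by positivity) (by norm_num), ← Real.rpow_natCast,
            ← Real.rpow_mul (by positivity), ← Real.rpow_mul (by positivity)]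
          simp only [Nat.cast_ofNat]
          rw [show (2 : ℝ) * (s * (1 / 2)) = s by ring]

/-- **Slots are bounded on `L²`**: `‖A u‖_{L²} ≤ ‖m_{i,ω}‖₀ ‖u‖_{L²}` (`Rot`, `Dil` are
isometries of `L²`, `‖m(D)‖ ≤ sup |m|`). [cite: Tao2016AveragedNS, §1.1 p. 6 and Def. 3.4] -/
theorem enorm_slot_le (u : L2C) : ‖𝒟.slot i θ u‖ₑ ≤ symbolSeminorm 0 (𝒟.m i θ) * ‖u‖ₑ := by
  have h := 𝒟.eFourierSobolevNorm_slot_le i θ le_rfl u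
  rwa [FunctionSpaces.eFourierSobolevNorm_zero_eq_enorm,
    FunctionSpaces.eFourierSobolevNorm_zero_eq_enorm, Real.rpow_zero, ENNReal.ofReal_one,
    mul_one] at h

end ComplexAveragingDatum

end Literature.Analysis.FluidPDE.Tao2016
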